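import Summits.ValiantsHypothesis.ValiantsHypothesis.Theorems.LacunarySymmetroidMatrixDescartesFiniteSectorRankOneRungDesign
import Summits.ValiantsHypothesis.ValiantsHypothesis.Theorems.LacunarySymmetroidMatrixDescartesFiniteSectorRealisable

/-!
# `MatrixDescartes` — line «finite» / «stamp»: the `(0,1,2)` LADDER — `FullyRealisable m ![0,1,2] (2m)` for EVERY `m`
# (the trivial diagonal rung, recorded for completeness of the fixed-support columns `d = 2, 3, m+1` known for all `m`)

HONEST FRAMING.  Object-search cell `pub-symmetroid`, seat val-sym-eng-3 g11 (census/instrument ENGINE #3 of D-0148 (b)).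
HELPER of the crux item `stmt-ValiantsHypothesis-18050`
(`Summit.ValiantsHypothesis.ValiantsHypothesis.Theses.LacunarySymmetroid.MatrixDescartes`, asymptotic in `K`) with NO closure
claim.  Instrument/structure tier, and mathematically TRIVIAL: on the support `(0,1,2)` the letters are unconstrained quadratics, so
the DIAGONAL pencil `diag((t − (2i+1))(t − (2i+2)))_{i<m}` = `S₀ + t S₁ + t² S₂` with `S₀ = diag((2i+1)(2i+2))`,
`S₁ = −diag(4i+3)`, `S₂ = 1` has determinant `∏_{j<2m} (t − (j+1))` of degree `2m` with the `2m` distinct positive zeros `1, …, 2m`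
— the ceiling `d(m+3−d) − 2 = 2m` of the support (`…FiniteSectorLadderCeiling.natDegree_le_ladder`).  Recorded so that the three
fixed-support columns of the `K = 3` stamp table that are known for ALL `m` sit side by side in the kernel: `(0,1,2) ↦ 2m` (here),
`(0,1,3) ↦ 3m − 2` (`…FiniteSectorLadderThree`, the arrow design), `(0,1,m+1) ↦ 2m` (`…FiniteSectorRankOneRung`, g10).  The sign
certificate reuses `half_prod_lower` of `…FiniteSectorRankOneRungDesign` at the points `k + ½`.
Nothing here bears on the crux (asymptotic in `K`) or on `VP ≠ VNP`.
[folklore] Bookkeeping; no citation is load-bearing.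
-/

-- `Summit.ValiantsHypothesis.ValiantsHypothesis.…` repeats a component by the D-0017 layout
-- (single-conjunct summit), which the `dupNamespace` linter flags; the name is mandated.
set_option linter.dupNamespace false

namespace Summit.ValiantsHypothesis.ValiantsHypothesis.Theorems.LacunarySymmetroidMatrixDescartes.FiniteSector

open scoped BigOperators Matrix
open Polynomial Finset Matrix

/-- The diagonal `(0,1,2)` pencil evaluated: `S₀ + t S₁ + t² S₂ = diag((t − (2i+1))(t − (2i+2)))`. [bookkeeping] -/
theorem diagPencil012_eval (m : ℕ) (t : ℝ) :
    (∑ l, t ^ (![0, 1, 2] : Fin 3 → ℕ) l •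
      (![diagonal fun i : Fin m => (2 * (i : ℝ) + 1) * (2 * (i : ℝ) + 2),
          diagonal fun i : Fin m => -((2 * (i : ℝ) + 1) + (2 * (i : ℝ) + 2)),
          (1 : Matrix (Fin m) (Fin m) ℝ)] : Fin 3 → Matrix (Fin m) (Fin m) ℝ) l)
      = diagonal fun i : Fin m => (t - (2 * (i : ℝ) + 1)) * (t - (2 * (i : ℝ) + 2)) := by
  rw [Fin.sum_univ_three]
  simp only [Matrix.cons_val_zero, Matrix.cons_val_one, Matrix.cons_val_two, Matrix.head_cons,
    Matrix.tail_cons, pow_zero, one_smul, pow_one]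
  ext i j
  simp only [Matrix.add_apply, Matrix.smul_apply, diagonal_apply, Matrix.one_apply, smul_eq_mul]
  split_ifs <;> ring

/-- The three diagonal letters are symmetric. [bookkeeping] -/
theorem diagPencil012_isSymm (m : ℕ) (l : Fin 3) :
    ((![diagonal fun i : Fin m => (2 * (i : ℝ) + 1) * (2 * (i : ℝ) + 2),
          diagonal fun i : Fin m => -((2 * (i : ℝ) + 1) + (2 * (i : ℝ) + 2)),
          (1 : Matrix (Fin m) (Fin m) ℝ)] : Fin 3 → Matrix (Fin m) (Fin m) ℝ) l).IsSymm := by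
  fin_cases l
  · exact isSymm_diagonal _
  · exact isSymm_diagonal _
  · exact Matrix.isSymm_one

/-- Pairs to a range: `∏_{i<m} (t − (2i+1))(t − (2i+2)) = ∏_{j<2m} (t − (j+1))`. [bookkeeping] -/
theorem prod_pairs_eq_prod_range (m : ℕ) (t : ℝ) :
    ∏ i : Fin m, (t - (2 * (i : ℝ) + 1)) * (t - (2 * (i : ℝ) + 2)) = ∏ j ∈ range (2 * m), (t - ((j : ℝ) + 1)) := by
  rw [Fin.prod_univ_eq_prod_range (fun i => (t - (2 * (i : ℝ) + 1)) * (t - (2 * (i : ℝ) + 2))) m]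
  induction m with
  | zero => simp
  | succ n ih =>
    rw [Finset.prod_range_succ, ih, show 2 * (n + 1) = 2 * n + 1 + 1 by ring, Finset.prod_range_succ,
      Finset.prod_range_succ]
    push_cast
    ring

/-- **The `(0,1,2)` ladder at every rung: `FullyRealisable m ![0,1,2] (2m)`** — the diagonal pencil with determinant
`∏_{j<2m} (t − (j+1))`, certified at the `2m + 1` points `k + ½` (`half_prod_lower`). [folklore] -/
theorem fullyRealisable_ladder012 (m : ℕ) : FullyRealisable m (![0, 1, 2] : Fin 3 → ℕ) (2 * m) := by
  classical
  set S : Fin 3 → Matrix (Fin m) (Fin m) ℝ :=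
    ![diagonal fun i : Fin m => (2 * (i : ℝ) + 1) * (2 * (i : ℝ) + 2),
      diagonal fun i : Fin m => -((2 * (i : ℝ) + 1) + (2 * (i : ℝ) + 2)),
      (1 : Matrix (Fin m) (Fin m) ℝ)] with hS
  set p : ℝ[X] := ∏ j ∈ range (2 * m), (X - C ((j : ℝ) + 1)) with hp
  have heval : ∀ t : ℝ, (∑ l, t ^ (![0, 1, 2] : Fin 3 → ℕ) l • S l).det = p.eval t := by
    intro t
    rw [hS, diagPencil012_eval, det_diagonal, prod_pairs_eq_prod_range, hp, Polynomial.eval_prod]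
    simp only [Polynomial.eval_sub, Polynomial.eval_X, Polynomial.eval_C]
  have hdeg : p.natDegree ≤ 2 * m := by
    rw [hp, Polynomial.natDegree_prod_of_monic _ _ fun j _ => monic_X_sub_C _,
      Finset.sum_congr rfl fun j _ => Polynomial.natDegree_X_sub_C _, Finset.sum_const, Finset.card_range,
      smul_eq_mul, mul_one]
  set τ : Fin (2 * m + 1) → ℝ := fun k => (k : ℝ) + 1 / 2 with hτ
  have hτpos : ∀ k, 0 < τ k := fun k => by rw [hτ]; positivity
  have hτmono : StrictMono τ := fun a b hab => by
    simp only [hτ]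
    have : (a : ℝ) < b := by exact_mod_cast hab
    linarith
  -- the signs `(-1)^{k + 2m} p(k + ½) > 0`
  have hsign : ∀ k : Fin (2 * m + 1), 0 < (-1 : ℝ) ^ ((k : ℕ) + 2 * m) * p.eval (τ k) := by
    intro k
    have hk : (k : ℕ) ≤ 2 * m := Nat.le_of_lt_succ k.isLt
    have h := half_prod_lower (2 * m) k hk
    have hev : p.eval (τ k) = ∏ j ∈ range (2 * m), (((k : ℕ) : ℝ) - 1 / 2 - j) := by
      rw [hp, Polynomial.eval_prod]
      refine Finset.prod_congr rfl fun j _ => ?_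
      simp only [Polynomial.eval_sub, Polynomial.eval_X, Polynomial.eval_C, hτ]
      ring
    rw [hev]
    exact lt_of_lt_of_le (by positivity) h
  refine fullyRealisable_of_certificate _ S (diagPencil012_isSymm m) p heval hdeg τ hτmono hτpos fun j => ?_
  rw [heval, heval]
  have h1 := hsign j.castSucc
  have h2 := hsign j.succ
  simp only [Fin.val_castSucc] at h1
  simp only [Fin.val_succ] at h2
  rw [show (j : ℕ) + 1 + 2 * m = ((j : ℕ) + 2 * m) + 1 by ring, pow_succ] at h2
  set s : ℝ := (-1 : ℝ) ^ ((j : ℕ) + 2 * m) with hs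
  have hss : s * s = 1 := by rw [hs, ← pow_add, ← two_mul, pow_mul]; norm_num
  have h12 := mul_pos h1 h2
  have hre : s * p.eval (τ j.castSucc) * (s * -1 * p.eval (τ j.succ))
      = -(s * s) * (p.eval (τ j.castSucc) * p.eval (τ j.succ)) := by ring
  rw [hre, hss] at h12
  linarith

end Summit.ValiantsHypothesis.ValiantsHypothesis.Theorems.LacunarySymmetroidMatrixDescartes.FiniteSector
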